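import Mathlib.LinearAlgebra.TensorProduct.Basis
import Literature.AlgebraicGeometry.Motives.HodgeTensor
import HarnessLib

/-!
# Discharged fact: the Hodge filtration on an internal Hom is separated

`Literature.AlgebraicGeometry.Motives.HodgeTensor` records as a named fact
(`Literature.HodgeStructure.exists_homFiltration_eq_bot : Prop`) that for pure `ℚ`-Hodge structures
`H₁` on `V` (weight `n`) and `H₂` on `W` (weight `m`), given by finite decreasing filtrations
`F` of `V_ℂ = ℂ ⊗[ℚ] V` and `W_ℂ`, the filtration
`F^p Hom(V, W) = {ξ | ξ_ℂ (F^a V_ℂ) ⊆ F^{a+p} W_ℂ for all a}` on `ℂ ⊗[ℚ] Hom_ℚ(V, W)`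
(`Literature.AlgebraicGeometry.Motives.HodgeStructure.homFiltration`, the filtration of Deligne, *Théorie de Hodge II*, (1.1.12):
"pour le foncteur exact à gauche `Hom`, on pose
`Fⁿ(Hom(A, B)) = {f : A → B | ∀ m, f(Fᵐ(A)) ⊂ F^{m+n}(B)}`", transported to
`ℂ ⊗[ℚ] Hom_ℚ(V, W)` along the comparison map
`homBaseChange : ℂ ⊗ Hom(V, W) → Hom_ℂ(V_ℂ, W_ℂ)`) is **separated**: some `F^p Hom(V, W)` is `0`.
In Deligne's language ((1.1.4): "une filtration `F` de `A` est dite finie s'il existe `n` et `m`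
tels que `Fⁿ(A) = A` et `Fᵐ(A) = 0`") this is one half of the finiteness of the filtration
(1.1.12) puts on `Hom` of two objects "de filtration finie"; the other half (exhaustion) is
already proved in `HodgeTensor` (`exists_homFiltration_eq_top`). This file proves it
(`Literature.AlgebraicGeometry.Motives.HodgeStructure.exists_homFiltration_eq_bot_holds`), with no finite-dimensionality
hypothesis on `V` or `W`, so that the field `HodgeTensorFacts.exists_homFiltration_eq_bot` can be
fed a theorem. (The companion file `HodgeTensorHomProofs` discharges the opposedness fact
`isCompl_homFiltration`, which needs `V` finite-dimensional; the statement of the present fact is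
unchanged and correct as vendored in `HodgeTensor`. No definition is introduced here.)

## Proof

Pick `t₁` with `F^{t₁} V_ℂ = V_ℂ` and `b₂` with `F^{b₂} W_ℂ = 0` and put `p = b₂ - t₁`. If
`ξ ∈ F^p Hom(V, W)` then `ξ_ℂ(V_ℂ) = ξ_ℂ(F^{t₁} V_ℂ) ⊆ F^{b₂} W_ℂ = 0`, i.e.
`homBaseChange ξ = 0`. It remains that `homBaseChange` is injective
(`homBaseChange_injective`), which holds for arbitrary `V`, `W` because `ℂ` is free over `ℚ`:
for a `ℚ`-basis `ℬ = (cᵢ)` of `ℂ` every `ξ ∈ ℂ ⊗ Hom(V, W)` is uniquely `Σ cᵢ ⊗ fᵢ`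
(Mathlib's `TensorProduct.equivFinsuppOfBasisLeft`), and the `i`-th coordinate of
`ξ_ℂ(1 ⊗ v) = Σ cᵢ ⊗ fᵢ(v) ∈ ℂ ⊗ W` is `fᵢ(v)` (`equivFinsuppOfBasisLeft_homBaseChange_ofRat`);
so `ξ_ℂ = 0` forces every `fᵢ = 0`.

## References

* P. Deligne, *Théorie de Hodge. II*, Publ. Math. IHÉS 40 (1971), 5–57: (1.1.4) (finite
  filtrations), (1.1.12) (filtration on a multiadditive functor, in particular on `Hom`), (1.1.6)
  (dual filtration). [DeligneHodgeII1971]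
* J. Carlson, S. Müller-Stach, C. Peters, *Period Mappings and Period Domains*, 2nd ed.,
  Cambridge Studies in Advanced Mathematics 168 (2017), Problem 1.2.7 (the Hodge structure of
  weight `m - n` on `Hom(A, B)`, `Hom(A, B)^{i,j} = {f | f(A^{p,q}) ⊂ B^{p+i,q+j}}`).
  [CarlsonMullerStachPeters2017]
-/

open scoped TensorProduct

noncomputable section

namespace Literature.AlgebraicGeometry.Motives

namespace HodgeStructure

universe u v w

variable {V : Type u} [AddCommGroup V] [Module ℚ V]
variable {W : Type v} [AddCommGroup W] [Module ℚ W]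

/-- Coordinates of `homBaseChange ξ` in a `ℚ`-basis `ℬ` of `ℂ`: if `ξ = Σᵢ ℬᵢ ⊗ fᵢ` in
`ℂ ⊗[ℚ] Hom(V, W)` (coordinates `fᵢ = equivFinsuppOfBasisLeft ℬ ξ i`), then
`ξ_ℂ (1 ⊗ v) = Σᵢ ℬᵢ ⊗ fᵢ(v)` in `ℂ ⊗[ℚ] W`, i.e. the `i`-th coordinate of
`homBaseChange V W ξ (1 ⊗ v)` is `fᵢ(v)`. [folklore] -/
theorem equivFinsuppOfBasisLeft_homBaseChange_ofRat {ι : Type w} [DecidableEq ι]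
    (ℬ : Module.Basis ι ℚ ℂ) (ξ : ℂ ⊗[ℚ] (V →ₗ[ℚ] W)) (i : ι) (v : V) :
    TensorProduct.equivFinsuppOfBasisLeft ℬ (homBaseChange V W ξ (ofRat v)) i =
      TensorProduct.equivFinsuppOfBasisLeft ℬ ξ i v := by
  induction ξ using TensorProduct.induction_on with
  | zero => simp
  | tmul c f => simp [TensorProduct.smul_tmul']
  | add x y hx hy => simp only [map_add, LinearMap.add_apply, Finsupp.add_apply, hx, hy]

variable (V W) in
/-- The comparison map `homBaseChange : ℂ ⊗[ℚ] Hom_ℚ(V, W) → Hom_ℂ(V_ℂ, W_ℂ)`, `c ⊗ f ↦ c • f_ℂ`,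
is injective for all `ℚ`-vector spaces `V`, `W` (no finiteness needed): `ℂ` being free over
`ℚ`, `ℂ ⊗ Hom(V, W) ≅ ⊕_ℬ Hom(V, W)` embeds in `Hom(V, ⊕_ℬ W) = Hom(V, ℂ ⊗ W)`. (It is moreover
bijective when `V` is finite-dimensional, which is not used here.) [folklore] -/
theorem homBaseChange_injective : Function.Injective (homBaseChange V W) := by
  classical
  let ℬ := Module.Basis.ofVectorSpace ℚ ℂ
  rw [injective_iff_map_eq_zero]
  intro ξ hξ
  apply (TensorProduct.equivFinsuppOfBasisLeft ℬ).injective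
  rw [map_zero]
  ext i v
  rw [← equivFinsuppOfBasisLeft_homBaseChange_ofRat ℬ ξ i v, hξ]
  simp

/-- **Separation of the Hom filtration** (discharge of the named fact
`HodgeStructure.exists_homFiltration_eq_bot`): for Hodge structures `H₁` on `V` and `H₂` on `W`
there is `p` with `F^p Hom(V, W) = 0`, namely `p = b₂ - t₁` where `F^{t₁} V_ℂ = V_ℂ` and
`F^{b₂} W_ℂ = 0`: an element of `F^{b₂ - t₁} Hom` maps `V_ℂ = F^{t₁}` into `F^{b₂} = 0`, so its
image under the injective `homBaseChange` vanishes. This is the separation half of the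
finiteness (Deligne, Hodge II, (1.1.4)) of the filtration that (1.1.12) puts on `Hom(A, B)` for
`A`, `B` of finite filtration: "`Fⁿ(Hom(A, B)) = {f : A → B | ∀ m, f(Fᵐ(A)) ⊂ F^{m+n}(B)}`".
[cite: DeligneHodgeII1971, 1.1.12 (with 1.1.4)] -/
theorem exists_homFiltration_eq_bot_holds {n m : ℤ} :
    exists_homFiltration_eq_bot (V := V) (W := W) (n := n) (m := m) := by
  intro H₁ H₂
  obtain ⟨t₁, ht₁⟩ := H₁.exists_F_eq_top
  obtain ⟨b₂, hb₂⟩ := H₂.exists_F_eq_bot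
  refine ⟨b₂ - t₁, eq_bot_iff.2 fun ξ hξ => ?_⟩
  rw [Submodule.mem_bot]
  apply homBaseChange_injective V W
  rw [map_zero]
  refine LinearMap.ext fun x => ?_
  have hx : homBaseChange V W ξ x ∈ H₂.F (t₁ + (b₂ - t₁)) := hξ t₁ x (by simp [ht₁])
  rwa [show t₁ + (b₂ - t₁) = b₂ by ring, hb₂, Submodule.mem_bot] at hx

end HodgeStructure

end Literature.AlgebraicGeometry.Motives

end
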